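import Literature.NumberTheory.Automorphic.UnitaryThreeTorusNormOneIndex        -- ★ γ3b: `coe_normOneMap_apply`, `isUnit_of_v_eq_one`, `v_normOneMap_sub_one_le_iff` (all 2-free); brings ★ (F3a) `UnramifiedQuadraticOrderUnitIndex`
import HarnessLib

/-!
# The norm-one group `E¹` of an UNRAMIFIED quadratic extension of local rings at ANY residue characteristic: Hilbert 90 with a UNIT from a generator `g` with
# `σg − g ∈ Rˣ`, and the index transfer `[E¹ : E¹ ∩ (1 + 𝔪^j)] = [Rˣ : U_j]` — the `|2| = 1`-free twin of ★ γ3b `UnitaryThreeTorusNormOneIndex`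
(Flicker (1998), Prop. 6 (c) p. 83, Prop. 7 p. 84; Serre, *Local Fields*, Ch. V §2)

Topic `NumberTheory/LocalFields`; namespace `Literature.NumberTheory.Automorphic.UnitaryGroup.TorusBridge` (the namespace of ★ γ3b, so that the trace-frame weight file F4
calls the twin by the same path).  THEOREMS ONLY (no definition, no instance, no notation, no named fact, no `sorry`).  Cell `pub/hodgecm-mathlib`, LH4 price list LAYER B 3∕3,
rider (r-d) of LH4-plan (g7) WORD #2 (CENSUS-LAYERB-3of3 4277d501 §1 row «★ γ3b», token T1): the ★ file proves Hilbert 90 with a unit under `|2| = 1` and a skew unit `d`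
(`σd = −d`, `|d| = 1`) — one of `1 ± μ` is a unit because `(1+μ) + (1−μ) = 2`.  Here the ONLY input is «the unramified quadratic situation» in the currency of ★
`LocalFields/UnramifiedQuadraticNorm*`: an element `g ∈ R` with `σg − g ∈ Rˣ`.  Seat LH5-p01 (g5).  HONEST LABEL: HC_CM is proved only modulo the printed citations
(hLiu418 = stmt-HodgeConjecture-24832, h413 = stmt-HodgeConjecture-24833) until rung 0 closes; this file is unconditional, elementary and count-neutral.

MATHEMATICS (bridge `(R, ι, hιv, σR, hσι)` as in ★ `UnitaryThreeTorusLatticeBridge`; `σR` an involution, `|σx| = |x|`).  HILBERT 90 WITH A UNIT (§1): if `μ·σμ = 1` then BOTH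
`l₁ := 1 + μ` and `l₂ := ι g + μ·σ(ι g)` satisfy `μ·σl = l`, and at least one of them is a unit: `l₂ − (ι g − σ(ι g)) = (1 + μ)·σ(ι g)`, so if `|1 + μ| < 1` then `|l₂| = |ι g − σ(ι g)|
= 1`.  Hence `μ = ι u ∕ σ(ι u)` with `u ∈ Rˣ` — at every residue characteristic (at a tame place `g := d∕2`-free: any `g` with `σg − g` a unit, e.g. `g = d` when `|2| = 1`; at a
dyadic place `g := b` with `b + σb = 1`).  The INDEX TRANSFER (§2) is then ★ γ3b's verbatim: for any group `G` and `f : G →* Kˣ` with norm-one values reaching every `ι u ∕ σ(ι u)`,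
`[G : {x : |f x − 1| ≤ |ϖ^j|}] = [Rˣ : U_j]`, `U_j = {u : σu ≡ u (𝔪^j)}` (so `= (q+1)q^{j−1}` for `j ≥ 1` by ★ `index_comap_eqLocus_eq`, `= 1` for `j = 0`).

* §1 `exists_unit_normOneMap_eq_of_isUnit_sub` — Hilbert 90 with a unit from `(hg : IsUnit (σR g − g))`.
* §2 `index_eq_index_units_of_normOne_of_isUnit_sub` — ★ `index_eq_index_units_of_normOne` with `(h2) (hd) (hvd)` replaced by `(hg)`.

## References
* [Flicker1998UnitaryFL] Y. Z. Flicker, *Elementary proof of the fundamental lemma for a unitary group*, Canad. J. Math. 50 (1998), Prop. 6 (c) p. 83, Prop. 7 p. 84.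
* [Serre1979] J.-P. Serre, *Local Fields*, GTM 67 (1979), Ch. V §2 Prop. 2–3 (units of an unramified extension; Hilbert 90).
-/

set_option autoImplicit false

open scoped WithZero

namespace Literature.NumberTheory.Automorphic.UnitaryGroup

namespace TorusBridge

open IsLocalRing Literature.NumberTheory.LocalFields.UnramifiedQuadraticNorm

universe u

variable {K : Type*} [Field K] [Valued K ℤᵐ⁰] (σ : K →+* K)
  {R : Type u} [CommRing R] (ι : R →+* K) (hι : Function.Injective ι)
  (hιv : ∀ x : K, Valued.v x ≤ 1 ↔ x ∈ Set.range ι) (σR : R →+* R) (hσι : ∀ r, ι (σR r) = σ (ι r))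

/-! ## §1 Hilbert 90 with a unit, from a generator with unit skew part -/

include hι hιv hσι in
/-- **HILBERT 90 WITH A UNIT, ANY RESIDUE CHARACTERISTIC**: if `σR` is an involution, `|σx| = |x|`, and some `g ∈ R` has `σg − g ∈ Rˣ` (the unramified quadratic situation),
then every `μ` with `μ·σμ = 1` is `ι u ∕ σ(ι u)` for a unit `u ∈ Rˣ` — with `u := 1 + μ` if that is a unit, else `u := g + μ·σg` (then `u − (g − σg) = (1 + μ)·σg ∈ 𝔪`, so `u`
is a unit); both satisfy `μ·σu = u`. Twin of ★ `exists_unit_normOneMap_eq` without `|2| = 1`. [cite: Serre1979, Ch. V §2 Prop. 3] [cite: Flicker1998UnitaryFL, Prop. 6 p. 83] -/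
theorem exists_unit_normOneMap_eq_of_isUnit_sub (hσR : ∀ r, σR (σR r) = r) (hvσ : ∀ x, Valued.v (σ x) = Valued.v x)
    {g : R} (hg : IsUnit (σR g - g)) {μ : K} (hμ : μ * σ μ = 1) : ∃ u : Rˣ, ι u / σ (ι u) = μ := by
  have hμ0 : μ ≠ 0 := fun h => by rw [h, zero_mul] at hμ; exact zero_ne_one hμ
  have hvμ : Valued.v μ = 1 := by
    have h1 := congrArg Valued.v hμ
    rw [map_mul, hvσ, map_one] at h1
    -- `x·x = 1 ⇒ x = 1` in `ℤᵐ⁰`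
    rcases lt_trichotomy (Valued.v μ) 1 with h | h | h
    · exact absurd h1 (ne_of_lt (mul_lt_one_of_nonneg_of_lt_one_left zero_le h h.le))
    · exact h
    · exact absurd h1 (ne_of_gt (one_lt_mul_of_lt_of_le h h.le))
  have hσσ : ∀ r : R, σ (σ (ι r)) = ι r := fun r => by rw [← hσι, ← hσι, hσR]
  -- the skew unit `ι(σg − g)` has valuation `1`
  have hdv : Valued.v (ι g - σ (ι g)) = 1 := by
    rw [← Valuation.map_neg, neg_sub, ← hσι, ← map_sub]; exact v_eq_one_of_isUnit ι hιv hg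
  -- from a unit `l` with `μ·σl = l` to the conclusion
  have key : ∀ l : K, Valued.v l = 1 → μ * σ l = l → ∃ u : Rˣ, ι u / σ (ι u) = μ := by
    intro l hl hμl
    obtain ⟨r, hr⟩ := (hιv l).1 hl.le
    have hu : IsUnit r := isUnit_of_v_eq_one ι hι hιv (by rw [hr, hl])
    refine ⟨hu.unit, ?_⟩
    rw [IsUnit.unit_spec, hr]
    have hσl0 : σ l ≠ 0 := by
      intro h0; have : Valued.v (σ l) = 0 := by rw [h0, map_zero]
      rw [hvσ, hl] at this; exact one_ne_zero this
    rw [div_eq_iff hσl0]; exact hμl.symm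
  by_cases hA : Valued.v (1 + μ) = 1
  · -- `l = 1 + μ`
    exact key (1 + μ) hA (by rw [map_add, map_one]; linear_combination hμ)
  · -- `l = ι g + μ·σ(ι g)`
    have hle1 : Valued.v (1 + μ) ≤ 1 := Valuation.map_add_le _ (by rw [map_one]) hvμ.le
    have hlt : Valued.v (1 + μ) < 1 := lt_of_le_of_ne hle1 hA
    have hgv : Valued.v (σ (ι g)) ≤ 1 := by rw [hvσ]; exact v_le_one ι hιv g
    have hsmall : Valued.v ((1 + μ) * σ (ι g)) < Valued.v (ι g - σ (ι g)) := by
      rw [hdv, map_mul]; exact mul_lt_one_of_nonneg_of_lt_one_left zero_le hlt hgv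
    have hl2 : Valued.v (ι g + μ * σ (ι g)) = 1 := by
      rw [show ι g + μ * σ (ι g) = (ι g - σ (ι g)) + (1 + μ) * σ (ι g) by ring, Valuation.map_add_eq_of_lt_left _ hsmall, hdv]
    exact key _ hl2 (by rw [map_add, map_mul, hσσ]; linear_combination (ι g) * hμ)

/-! ## §2 The index transfer `[E¹ : E¹ ∩ (1+𝔪^j)] = [Rˣ : U_j]`, any residue characteristic -/

include hι hιv hσι in
/-- **THE WEIGHT TRANSFER, ANY RESIDUE CHARACTERISTIC** — ★ `index_eq_index_units_of_normOne` with `(h2 : |2| = 1) (hd : σd = −d) (hvd : |d| = 1)` replaced by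
`{g : R} (hg : IsUnit (σR g − g))`: for ANY group `G` with a homomorphism `f : G →* Kˣ` whose values are norm-one and which reaches every `ι u ∕ σ(ι u)` (`u ∈ Rˣ`), the
subgroup `S = {x : |f x − 1| ≤ |ϖ|^j}` has index `[G : S] = [Rˣ : U_j]`, `U_j = {u : σu ≡ u (𝔪^j)}` the subgroup of ★ `UnramifiedQuadraticOrderUnitIndex` (`= (q+1)q^{j−1}` for
`j ≥ 1` by ★ `index_comap_eqLocus_eq`, `= 1` for `j = 0`).  Proof = ★'s verbatim over §1. [cite: Flicker1998UnitaryFL, Prop. 6 (c) p. 83, Prop. 7 p. 84] [cite: Serre1979, Ch. V §2] -/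
theorem index_eq_index_units_of_normOne_of_isUnit_sub [IsDomain R] [IsDiscreteValuationRing R] (hσR : ∀ r, σR (σR r) = r)
    (hvσ : ∀ x, Valued.v (σ x) = Valued.v x) {g : R} (hg : IsUnit (σR g - g))
    {ϖR : R} (hϖR : Irreducible ϖR) {G : Type*} [Group G] (f : G →* Kˣ)
    (hf : ∀ x, ((f x : Kˣ) : K) * σ ((f x : Kˣ) : K) = 1) (hfs : ∀ u : Rˣ, ∃ x, ((f x : Kˣ) : K) = ι u / σ (ι u))
    (S : Subgroup G) (j : ℕ) (hS : ∀ x, x ∈ S ↔ Valued.v (((f x : Kˣ) : K) - 1) ≤ Valued.v (ι ϖR ^ j)) :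
    S.index = (((Units.map (Ideal.quotientMap (maximalIdeal R ^ j) σR (maximalIdeal_pow_le_comap σR hσR j)).toMonoidHom).eqLocus
      (MonoidHom.id _)).comap (Units.map (Ideal.Quotient.mk (maximalIdeal R ^ j)).toMonoidHom)).index := by
  classical
  -- the norm-one map `g₀` and its range
  set g₀ : Rˣ →* Kˣ := Units.map (ι : R →* K) / Units.map ((σ : K →* K).comp (ι : R →* K)) with hg₀
  have hgv : ∀ u : Rˣ, ((g₀ u : Kˣ) : K) = ι u / σ (ι u) := fun u => coe_normOneMap_apply σ ι u
  set U : Subgroup Rˣ := ((Units.map (Ideal.quotientMap (maximalIdeal R ^ j) σR (maximalIdeal_pow_le_comap σR hσR j)).toMonoidHom).eqLocus (MonoidHom.id _)).comap (Units.map (Ideal.Quotient.mk (maximalIdeal R ^ j)).toMonoidHom) with hU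
  have hUmem : ∀ u : Rˣ, u ∈ U ↔ σR (u : R) - u ∈ maximalIdeal R ^ j := fun u => mem_comap_eqLocus_iff σR hσR j u
  -- `f` lands in `range g₀` (Hilbert 90 with a unit, §1) and is onto it
  have hfr : ∀ x, f x ∈ g₀.range := by
    intro x
    obtain ⟨u, hu⟩ := exists_unit_normOneMap_eq_of_isUnit_sub σ ι hι hιv σR hσι hσR hvσ hg (hf x)
    exact ⟨u, Units.ext (by rw [hgv, hu])⟩
  let f' : G →* ↥g₀.range := f.codRestrict g₀.range hfr
  have hf'v : ∀ x, (((f' x : ↥g₀.range) : Kˣ) : K) = ((f x : Kˣ) : K) := fun _ => rfl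
  have hgr : ∀ u : Rˣ, (((g₀.rangeRestrict u : ↥g₀.range) : Kˣ) : K) = ι u / σ (ι u) := fun u => by
    rw [MonoidHom.coe_rangeRestrict, hgv]
  have hf's : Function.Surjective f' := by
    intro y
    obtain ⟨u, hu⟩ := MonoidHom.mem_range.1 y.2
    obtain ⟨x, hx⟩ := hfs u
    refine ⟨x, Subtype.ext (Units.ext ?_)⟩
    rw [hf'v, hx, ← hgv, hu]
  -- `S = (U.map g₀.rangeRestrict).comap f'`
  have hSeq : S = (U.map g₀.rangeRestrict).comap f' := by
    ext x
    rw [hS, Subgroup.mem_comap, Subgroup.mem_map]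
    constructor
    · intro hx
      obtain ⟨u, hu⟩ := exists_unit_normOneMap_eq_of_isUnit_sub σ ι hι hιv σR hσι hσR hvσ hg (hf x)
      refine ⟨u, ?_, Subtype.ext (Units.ext ?_)⟩
      · rw [hUmem, ← v_normOneMap_sub_one_le_iff σ ι hι hιv σR hσι hvσ hϖR j u, hu]
        exact hx
      · rw [hgr, hf'v, hu]
    · rintro ⟨u, huU, hux⟩
      have hval : ι u / σ (ι u) = ((f x : Kˣ) : K) := by rw [← hgr u, ← hf'v x, hux]
      rw [← hval, v_normOneMap_sub_one_le_iff σ ι hι hιv σR hσι hvσ hϖR j u]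
      exact (hUmem u).1 huU
  -- indices
  have hker : g₀.rangeRestrict.ker ≤ U := by
    intro u hu
    rw [MonoidHom.mem_ker] at hu
    have h1 : ι u / σ (ι u) = 1 := by rw [← hgr u, hu]; rfl
    have h0 : σ (ι u) ≠ 0 := (map_ne_zero σ).2 fun h => (Units.ne_zero u) (hι (by rw [h, map_zero]))
    rw [div_eq_one_iff_eq h0, ← hσι] at h1
    have h3 : σR (u : R) - u = 0 := by rw [← hι h1, sub_self]
    rw [hUmem, h3]
    exact Ideal.zero_mem _
  rw [hSeq, Subgroup.index_comap_of_surjective _ hf's, Subgroup.index_map, MonoidHom.range_eq_top_of_surjective _ (MonoidHom.rangeRestrict_surjective g₀),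
    Subgroup.index_top, mul_one, sup_eq_left.2 hker]

end TorusBridge

end Literature.NumberTheory.Automorphic.UnitaryGroup
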